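import Summits.CriticalPhenomena.PercolationContinuityZ3.Theorems.Transplant.FKConnectivityAllQForestTwoSeparation
import Summits.CriticalPhenomena.PercolationContinuityZ3.Theorems.Transplant.FKConnectivityAllQForestAdjacentDegThree
import HarnessLib

/-!
# The square-free adjacent forest Rayleigh inequality is CLOSED UNDER 2-SUMS (pairs on different sides): the node for the two parts with
# the virtual pair implies the node for the glued fibre — "a minimal counterexample has no 2-separation between `e` and `f`"

Support file (`--supports stmt-CriticalPhenomena-4575`), FK sub-lane `prim-bschramm-fk-1` (gen 18) of the post-continuity programme;
builds on p205010 (kernel theorem, internal audit signed; external expert review pending).  No definitions, no named facts, no sorries;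
standard axioms.

SETTING.  Pairs of `E₁` live on `V₁`, pairs of `E₂` on `V₂`, `V₁ ∩ V₂ ⊆ {a, b}` (`a ≠ b`), `E₁ ∩ E₂ = ∅`; a fibre `(M, u)` with `M ∪ u ⊆ E₁ ∪ E₂`
splits into the side fibres `(M ∩ E_i, u ∩ E_i)`; `e ∈ M ∩ E₁`, `f ∈ M ∩ E₂` (for the node: `e = ov`, `f = oy` with `o ∈ {a, b}` a
separator, so that `e, h` and `f, h` are again ADJACENT pairs, `h = ab` the virtual pair).
* **`fibreCount_eq_sum_twoSep`**: every fibre count on `(M, u)` is the sum over the side-1 fibre of a count on the side-2 fibre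
  (`ω ↦ (ω ∩ E₁, ω ∩ E₂)`, partners factorise: `ω ∆ M = (ω₁ ∆ (M ∩ E₁)) ∪ (ω₂ ∆ (M ∩ E₂))`);
* **`sum_swap_le`**: the rearrangement step `Σ g(p,q) ≤ Σ g(q,p)` when `#{q} ≤ #{p}` and `g(1,0) ≤ g(0,1)`;
* **`adjForestNoSq_fibre_of_twoSep`**: if on side 1 `#{e ∈ ω₁, ω₁, ω₁∆(M ∩ E₁) ∈ Fo, a ~ b in ω₁∆(M ∩ E₁)} ≤ #{e ∈ ω₁, …, a ~ b in ω₁}` and likewise on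
  side 2 with `f` (these are exactly the node's inequalities for `(G_i + h; e or f, h)`, cf. `fibreCount_insert_one` of
  `…ForestAdjacentDegThree.lean`), then `#(Fo ∩ {e, f ∈ ω}, Fo) ≤ #(Fo ∩ {e ∈ ω}, Fo ∩ {f ∈ ω})` on `(M, u)`.
  Mechanism (memo bschramm/FROM-fk-1-g18-VERTEX-NC.md §4b, fibre-level form): with `α_i = [a ~ b in ω_i]`, `β_i = [a ~ b in ω_i ∆ M_i]`,
  forests glue iff not both sides join `a, b` (`isForestCfg_union_iff_of_twoSep`), the side-2 involution `ω₂ ↦ ω₂ ∆ (M ∩ E₂)` turns `good` into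
  the `bad`-shaped sum with `(α₁, β₁)` exchanged, and `good − bad = (#α₁ − #β₁)·(#α₂ − #β₂) ≥ 0` — the forest case of the two-sum
  factorisation behind Wagner's Theorem 5.8(d) (cf. fk-1 g6 `…TwoSum.lean` for `φ_{w,q}`).
[cite: Wagner2006, Thm. 5.8, §5.3 (pp. 14–15)] [cite: SempleWelsh2008, Prop. 4.1 (p. 11); Conj. 1.1 (p. 2)] [cite: Linusson2011, Prop. 2.6]
[cite: Grimmett2006, §3.8 (pp. 61–62)]
-/

noncomputable section

namespace Summit.CriticalPhenomena.PercolationContinuityZ3.Theorems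

namespace FK

open Set Literature.Probability.LatticeModels Literature.Probability.Percolation
open scoped Classical symmDiff

/-! ### A rearrangement step -/

/-- **Rearrangement**: for Booleans `p, q` on a finite set and `g : Bool → Bool → ℕ` with `g true false ≤ g false true`, if `#{q} ≤ #{p}` then
`Σ g (p x) (q x) ≤ Σ g (q x) (p x)`. [folklore] -/
theorem sum_swap_le {X : Type*} (s : Finset X) (p q : X → Bool) (g : Bool → Bool → ℕ) (hg : g true false ≤ g false true)
    (hc : (s.filter fun x => q x = true).card ≤ (s.filter fun x => p x = true).card) :
    ∑ x ∈ s, g (p x) (q x) ≤ ∑ x ∈ s, g (q x) (p x) := by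
  -- pointwise identity `g(p,q) + [p∧¬q]·g01 + [¬p∧q]·g10 = g(q,p) + [p∧¬q]·g10 + [¬p∧q]·g01`
  have hpt : ∀ x, g (p x) (q x) + ((if p x = true ∧ q x = false then 1 else 0) * g false true +
      (if p x = false ∧ q x = true then 1 else 0) * g true false) =
      g (q x) (p x) + ((if p x = true ∧ q x = false then 1 else 0) * g true false +
      (if p x = false ∧ q x = true then 1 else 0) * g false true) := by
    intro x
    cases hp : p x <;> cases hq : q x <;> simp <;> omega
  have hsum := Finset.sum_congr rfl fun x (_ : x ∈ s) => hpt x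
  rw [Finset.sum_add_distrib, Finset.sum_add_distrib, Finset.sum_add_distrib, Finset.sum_add_distrib, ← Finset.sum_mul, ← Finset.sum_mul,
    ← Finset.sum_mul, ← Finset.sum_mul, Finset.sum_boole, Finset.sum_boole] at hsum
  -- the class sizes
  set c10 := (s.filter fun x => p x = true ∧ q x = false).card with hc10
  set c01 := (s.filter fun x => p x = false ∧ q x = true).card with hc01
  have hcp : (s.filter fun x => p x = true).card = (s.filter fun x => p x = true ∧ q x = true).card + c10 := by
    rw [hc10, ← Finset.card_union_of_disjoint]
    · congr 1; ext x; simp only [Finset.mem_filter, Finset.mem_union]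
      cases q x <;> simp
    · rw [Finset.disjoint_left]; intro x h1 h2
      rw [Finset.mem_filter] at h1 h2; rw [h1.2.2] at h2; exact Bool.noConfusion h2.2.2
  have hcq : (s.filter fun x => q x = true).card = (s.filter fun x => p x = true ∧ q x = true).card + c01 := by
    rw [hc01, ← Finset.card_union_of_disjoint]
    · congr 1; ext x; simp only [Finset.mem_filter, Finset.mem_union]
      cases p x <;> simp
    · rw [Finset.disjoint_left]; intro x h1 h2
      rw [Finset.mem_filter] at h1 h2; rw [h1.2.1] at h2; exact Bool.noConfusion h2.2.1
  have hle : c01 ≤ c10 := by omega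
  obtain ⟨d, hd⟩ := Nat.exists_eq_add_of_le hle
  obtain ⟨r, hr⟩ := Nat.exists_eq_add_of_le hg
  simp only [Nat.cast_id] at hsum
  have key : c10 * g false true + c01 * g true false = (c10 * g true false + c01 * g false true) + d * r := by
    rw [hd, hr]; ring
  omega

/-! ### Splitting a fibre across two disjoint supports -/

section Split

variable {V : Type*} {E₁ E₂ : Set (Sym2 V)} {M u : BondConfig V}

/-- On `E₁ ∪ E₂`: the `E₁`-part of a configuration of the fibre `(M, u)` lies on the fibre `(M ∩ E₁, u ∩ E₁)`. [folklore] -/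
theorem inter_sdiff_inter_of_fibre {ω : BondConfig V} (hω : ω \ M = u) (E : Set (Sym2 V)) : (ω ∩ E) \ (M ∩ E) = u ∩ E := by
  ext x; rw [← hω]
  simp only [mem_sdiff, mem_inter_iff, not_and]
  tauto

/-- Configurations of the fibre `(M, u)` lie inside `M ∪ u`. [folklore] -/
theorem subset_union_of_fibre' {ω : BondConfig V} (hω : ω \ M = u) : ω ⊆ M ∪ u := fun x hx => by
  by_cases hxM : x ∈ M
  · exact Or.inl hxM
  · exact Or.inr (hω ▸ ⟨hx, hxM⟩)

/-- Gluing: for `ω₁` on the fibre `(M ∩ E₁, u ∩ E₁)` and `ω₂` on `(M ∩ E₂, u ∩ E₂)` (disjoint supports, `M ∪ u ⊆ E₁ ∪ E₂`),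
`ω₁ ∪ ω₂` lies on `(M, u)`. [folklore] -/
theorem union_sdiff_of_fibres (hMu : M ∪ u ⊆ E₁ ∪ E₂) {ω₁ ω₂ : BondConfig V}
    (h₁ : ω₁ \ (M ∩ E₁) = u ∩ E₁) (h₂ : ω₂ \ (M ∩ E₂) = u ∩ E₂) : (ω₁ ∪ ω₂) \ M = u := by
  have hω₁ : ω₁ ⊆ E₁ := fun x hx => ((subset_union_of_fibre' h₁) hx).elim (fun h => h.2) (fun h => h.2)
  have hω₂ : ω₂ ⊆ E₂ := fun x hx => ((subset_union_of_fibre' h₂) hx).elim (fun h => h.2) (fun h => h.2)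
  ext x
  simp only [mem_sdiff, mem_union]
  constructor
  · rintro ⟨hx | hx, hxM⟩
    · have : x ∈ ω₁ \ (M ∩ E₁) := ⟨hx, fun h => hxM h.1⟩
      rw [h₁] at this; exact this.1
    · have : x ∈ ω₂ \ (M ∩ E₂) := ⟨hx, fun h => hxM h.1⟩
      rw [h₂] at this; exact this.1
  · intro hxu
    rcases hMu (Or.inr hxu) with hx1 | hx2
    · have : x ∈ ω₁ \ (M ∩ E₁) := by rw [h₁]; exact ⟨hxu, hx1⟩
      exact ⟨Or.inl this.1, fun h => this.2 ⟨h, hx1⟩⟩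
    · have : x ∈ ω₂ \ (M ∩ E₂) := by rw [h₂]; exact ⟨hxu, hx2⟩
      exact ⟨Or.inr this.1, fun h => this.2 ⟨h, hx2⟩⟩

/-- The partner factorises: `(ω₁ ∪ ω₂) ∆ M = (ω₁ ∆ (M ∩ E₁)) ∪ (ω₂ ∆ (M ∩ E₂))` for `ω_i ⊆ E_i`, `M ⊆ E₁ ∪ E₂`, `E₁ ∩ E₂ = ∅`. [folklore] -/
theorem union_symmDiff_eq (hd : Disjoint E₁ E₂) (hM : M ⊆ E₁ ∪ E₂) {ω₁ ω₂ : BondConfig V} (hω₁ : ω₁ ⊆ E₁) (hω₂ : ω₂ ⊆ E₂) :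
    (ω₁ ∪ ω₂) ∆ M = (ω₁ ∆ (M ∩ E₁)) ∪ (ω₂ ∆ (M ∩ E₂)) := by
  have hE : ∀ x, x ∈ E₁ → x ∉ E₂ := fun x h1 h2 => Set.disjoint_left.1 hd h1 h2
  ext x
  simp only [Set.mem_symmDiff, mem_union, mem_inter_iff]
  by_cases hx1 : x ∈ E₁
  · have hx2 : x ∉ E₂ := hE x hx1
    have : x ∉ ω₂ := fun h => hx2 (hω₂ h)
    tauto
  · have : x ∉ ω₁ := fun h => hx1 (hω₁ h)
    by_cases hx2 : x ∈ E₂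
    · tauto
    · have hxM : x ∉ M := fun h => (hM h).elim hx1 hx2
      have : x ∉ ω₂ := fun h => hx2 (hω₂ h)
      tauto

variable [Fintype V]

/-- **Splitting a fibre count across two disjoint supports**: `#_{(M,u)}(A, B)` is the sum over the side-1 fibre `(M ∩ E₁, u ∩ E₁)` of the
side-2 fibre counts `#_{(M ∩ E₂, u ∩ E₂)}({ω₂ | ω₁ ∪ ω₂ ∈ A}, {ζ | (ω₁ ∆ (M ∩ E₁)) ∪ ζ ∈ B})`. [cite: Linusson2011, Prop. 2.6] -/
theorem fibreCount_eq_sum_twoSep (hd : Disjoint E₁ E₂) (hMu : M ∪ u ⊆ E₁ ∪ E₂) (A B : Set (BondConfig V)) :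
    fibreCount M u A B = ∑ ω₁ ∈ Finset.univ.filter (fun ω₁ : BondConfig V => ω₁ \ (M ∩ E₁) = u ∩ E₁),
      fibreCount (M ∩ E₂) (u ∩ E₂) {ω₂ | ω₁ ∪ ω₂ ∈ A} {ζ | (ω₁ ∆ (M ∩ E₁)) ∪ ζ ∈ B} := by
  have hM : M ⊆ E₁ ∪ E₂ := fun x hx => hMu (Or.inl hx)
  have hE : ∀ x, x ∈ E₁ → x ∉ E₂ := fun x h1 h2 => Set.disjoint_left.1 hd h1 h2
  unfold fibreCount
  rw [Finset.card_eq_sum_card_fiberwise (f := fun ω : BondConfig V => ω ∩ E₁)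
    (t := Finset.univ.filter fun ω₁ : BondConfig V => ω₁ \ (M ∩ E₁) = u ∩ E₁)
    (fun ω hω => by
      rw [Finset.mem_coe, Finset.mem_filter] at hω
      rw [Finset.mem_coe, Finset.mem_filter]
      exact ⟨Finset.mem_univ _, inter_sdiff_inter_of_fibre hω.2.1 E₁⟩)]
  refine Finset.sum_congr rfl fun ω₁ hω₁ => ?_
  rw [Finset.mem_filter] at hω₁
  have hω₁E : ω₁ ⊆ E₁ := fun x hx => ((subset_union_of_fibre' hω₁.2) hx).elim (fun h => h.2) (fun h => h.2)
  -- bijection `ω ↦ ω ∩ E₂`, inverse `ω₂ ↦ ω₁ ∪ ω₂`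
  refine Finset.card_bij' (fun ω _ => ω ∩ E₂) (fun ω₂ _ => ω₁ ∪ ω₂) (fun ω hω => ?_) (fun ω₂ hω₂ => ?_) (fun ω hω => ?_)
    (fun ω₂ hω₂ => ?_)
  · rw [Finset.mem_filter, Finset.mem_filter] at hω
    obtain ⟨⟨-, hfib, hA, hB⟩, hωE⟩ := hω
    have hωsub : ω ⊆ E₁ ∪ E₂ := (subset_union_of_fibre' hfib).trans hMu
    have hsplit : ω = ω₁ ∪ (ω ∩ E₂) := by
      rw [← hωE, ← inter_union_distrib_left, inter_eq_self_of_subset_left hωsub]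
    rw [Finset.mem_filter]
    refine ⟨Finset.mem_univ _, inter_sdiff_inter_of_fibre hfib E₂, ?_, ?_⟩
    · show ω₁ ∪ ω ∩ E₂ ∈ A
      rw [← hsplit]; exact hA
    · show (ω₁ ∆ (M ∩ E₁)) ∪ ((ω ∩ E₂) ∆ (M ∩ E₂)) ∈ B
      rw [← union_symmDiff_eq hd hM hω₁E inter_subset_right, ← hsplit]; exact hB
  · rw [Finset.mem_filter] at hω₂
    obtain ⟨-, hfib₂, hA, hB⟩ := hω₂
    have hω₂E : ω₂ ⊆ E₂ := fun x hx => ((subset_union_of_fibre' hfib₂) hx).elim (fun h => h.2) (fun h => h.2)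
    rw [Finset.mem_filter, Finset.mem_filter]
    refine ⟨⟨Finset.mem_univ _, union_sdiff_of_fibres hMu hω₁.2 hfib₂, hA, ?_⟩, ?_⟩
    · rw [union_symmDiff_eq hd hM hω₁E hω₂E]; exact hB
    · show (ω₁ ∪ ω₂) ∩ E₁ = ω₁
      rw [union_inter_distrib_right, inter_eq_self_of_subset_left hω₁E,
        (Set.disjoint_left.2 fun x hx2 hx1 => hE x hx1 (hω₂E hx2) : Disjoint ω₂ E₁).inter_eq, union_empty]
  · rw [Finset.mem_filter, Finset.mem_filter] at hω
    obtain ⟨⟨-, hfib, -, -⟩, hωE⟩ := hω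
    have hωsub : ω ⊆ E₁ ∪ E₂ := (subset_union_of_fibre' hfib).trans hMu
    show ω₁ ∪ (ω ∩ E₂) = ω
    rw [← hωE, ← inter_union_distrib_left, inter_eq_self_of_subset_left hωsub]
  · rw [Finset.mem_filter] at hω₂
    have hω₂E : ω₂ ⊆ E₂ := fun x hx => ((subset_union_of_fibre' hω₂.2.1) hx).elim (fun h => h.2) (fun h => h.2)
    show (ω₁ ∪ ω₂) ∩ E₂ = ω₂
    rw [union_inter_distrib_right, inter_eq_self_of_subset_left hω₂E,
      (Set.disjoint_left.2 fun x hx1 hx2 => hE x (hω₁E hx1) hx2 : Disjoint ω₁ E₂).inter_eq, empty_union]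

/-- A fibre count is the cardinality of any finset with the same members. [cite: Linusson2011, Prop. 2.6] -/
theorem fibreCount_eq_card_of_iff (M u : BondConfig V) (A B : Set (BondConfig V)) (s : Finset (BondConfig V))
    (h : ∀ ω, ω ∈ s ↔ (ω \ M = u ∧ ω ∈ A ∧ ω ∆ M ∈ B)) : fibreCount M u A B = s.card := by
  unfold fibreCount
  refine congrArg Finset.card (Finset.ext fun ω => ?_)
  rw [Finset.mem_filter, h]
  simp only [Finset.mem_univ, true_and]

end Split

/-! ### Closure of the node's fibre inequality under 2-sums (pairs on different sides) -/

section TwoSum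

variable {V : Type*} [Fintype V] {E₁ E₂ : Set (Sym2 V)} {V₁ V₂ : Set V} {a b : V} {M u : BondConfig V} {e f : Sym2 V}

/-- **(♣)⁰ across a 2-separation.**  With the pairs of `E_i` on `V_i`, `V₁ ∩ V₂ ⊆ {a,b}`, `a ≠ b`, `E₁ ∩ E₂ = ∅`, a fibre `(M, u)` on `E₁ ∪ E₂`,
`e ∈ M ∩ E₁`, `f ∈ M ∩ E₂`: if on the side fibres `(M_i, u_i) = (M ∩ E_i, u ∩ E_i)`
`#_{((M ∩ E₁),(u ∩ E₁))}(Fo ∩ {e ∈ ω}, Fo ∩ {a ~ b}) ≤ #_{((M ∩ E₁),(u ∩ E₁))}(Fo ∩ {e ∈ ω} ∩ {a ~ b}, Fo)` and the same on side 2 with `f`, then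
`#_{(M,u)}(Fo ∩ {e, f ∈ ω}, Fo) ≤ #_{(M,u)}(Fo ∩ {e ∈ ω}, Fo ∩ {f ∈ ω})`. [cite: Wagner2006, Thm. 5.8, §5.3 (pp. 14–15)]
[cite: SempleWelsh2008, Conj. 1.1 (p. 2)] [cite: Linusson2011, Prop. 2.6] -/
theorem adjForestNoSq_fibre_of_twoSep (h₁ : ∀ g ∈ E₁, ∀ z ∈ g, z ∈ V₁) (h₂ : ∀ g ∈ E₂, ∀ z ∈ g, z ∈ V₂) (hS : V₁ ∩ V₂ ⊆ {a, b})
    (hab : a ≠ b) (hd : Disjoint E₁ E₂) (hMu : M ∪ u ⊆ E₁ ∪ E₂) (he : e ∈ M ∩ E₁) (hf : f ∈ M ∩ E₂)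
    (H₁ : fibreCount (M ∩ E₁) (u ∩ E₁) (forestEv V ∩ {ω | e ∈ ω}) (forestEv V ∩ {ω | (openGraph ω).Reachable a b}) ≤
      fibreCount (M ∩ E₁) (u ∩ E₁) (forestEv V ∩ {ω | e ∈ ω} ∩ {ω | (openGraph ω).Reachable a b}) (forestEv V))
    (H₂ : fibreCount (M ∩ E₂) (u ∩ E₂) (forestEv V ∩ {ω | f ∈ ω}) (forestEv V ∩ {ω | (openGraph ω).Reachable a b}) ≤
      fibreCount (M ∩ E₂) (u ∩ E₂) (forestEv V ∩ {ω | f ∈ ω} ∩ {ω | (openGraph ω).Reachable a b}) (forestEv V)) :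
    fibreCount M u (forestEv V ∩ {ω | e ∈ ω ∧ f ∈ ω}) (forestEv V) ≤
      fibreCount M u (forestEv V ∩ {ω | e ∈ ω}) (forestEv V ∩ {ω | f ∈ ω}) := by
  have hE : ∀ x, x ∈ E₁ → x ∉ E₂ := fun x hx1 hx2 => Set.disjoint_left.1 hd hx1 hx2
  have hM1E : M ∩ E₁ ⊆ E₁ := inter_subset_right
  have hM2E : M ∩ E₂ ⊆ E₂ := inter_subset_right
  have hfE₁ : f ∉ E₁ := fun h => hE f h hf.2
  have heE₂ : e ∉ E₂ := hE e he.2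
  have sub₁ : ∀ {ω₁ : BondConfig V}, ω₁ \ (M ∩ E₁) = u ∩ E₁ → ω₁ ⊆ E₁ :=
    fun h x hx => ((subset_union_of_fibre' h) hx).elim (fun h => h.2) (fun h => h.2)
  have sub₂ : ∀ {ω₂ : BondConfig V}, ω₂ \ (M ∩ E₂) = u ∩ E₂ → ω₂ ⊆ E₂ :=
    fun h x hx => ((subset_union_of_fibre' h) hx).elim (fun h => h.2) (fun h => h.2)
  have subB₁ : ∀ {ω₁ : BondConfig V}, ω₁ \ (M ∩ E₁) = u ∩ E₁ → ω₁ ∆ (M ∩ E₁) ⊆ E₁ :=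
    fun h => (symmDiff_subset_union).trans (union_subset (sub₁ h) hM1E)
  have subB₂ : ∀ {ω₂ : BondConfig V}, ω₂ \ (M ∩ E₂) = u ∩ E₂ → ω₂ ∆ (M ∩ E₂) ⊆ E₂ :=
    fun h => (symmDiff_subset_union).trans (union_subset (sub₂ h) hM2E)
  have glue : ∀ {ω₁ ω₂ : BondConfig V}, ω₁ ⊆ E₁ → ω₂ ⊆ E₂ →
      (IsForestCfg (ω₁ ∪ ω₂) ↔ IsForestCfg ω₁ ∧ IsForestCfg ω₂ ∧ ¬ ((openGraph ω₁).Reachable a b ∧ (openGraph ω₂).Reachable a b)) :=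
    fun hω₁ hω₂ => isForestCfg_union_iff_of_twoSep h₁ h₂ hS hab hd hω₁ hω₂
  -- opaque names with defining equations: side-1 class `S₁`, Booleans `p, q`, side-2 counts `g`
  obtain ⟨S₁, hS₁⟩ : ∃ s : Finset (BondConfig V), s = Finset.univ.filter fun ω₁ =>
      ω₁ \ (M ∩ E₁) = u ∩ E₁ ∧ (e ∈ ω₁ ∧ IsForestCfg ω₁ ∧ IsForestCfg (ω₁ ∆ (M ∩ E₁))) := ⟨_, rfl⟩
  obtain ⟨p, hp⟩ : ∃ p : BondConfig V → Bool, ∀ ω₁, p ω₁ = decide ((openGraph ω₁).Reachable a b) := ⟨_, fun _ => rfl⟩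
  obtain ⟨q, hq⟩ : ∃ q : BondConfig V → Bool, ∀ ω₁, q ω₁ = decide ((openGraph (ω₁ ∆ (M ∩ E₁))).Reachable a b) :=
    ⟨_, fun _ => rfl⟩
  obtain ⟨g, hg⟩ : ∃ g : Bool → Bool → ℕ, ∀ x y, g x y = fibreCount (M ∩ E₂) (u ∩ E₂)
      (forestEv V ∩ {ω | f ∈ ω} ∩ {ω | ¬ (x = true ∧ (openGraph ω).Reachable a b)})
      (forestEv V ∩ {ω | ¬ (y = true ∧ (openGraph ω).Reachable a b)}) := ⟨_, fun _ _ => rfl⟩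
  have hpiff : ∀ ω₁, p ω₁ = true ↔ (openGraph ω₁).Reachable a b := fun ω₁ => by rw [hp]; exact decide_eq_true_iff
  have hqiff : ∀ ω₁, q ω₁ = true ↔ (openGraph (ω₁ ∆ (M ∩ E₁))).Reachable a b := fun ω₁ => by rw [hq]; exact decide_eq_true_iff
  have memS₁ : ∀ ω₁, ω₁ ∈ S₁ ↔ ω₁ \ (M ∩ E₁) = u ∩ E₁ ∧ (e ∈ ω₁ ∧ IsForestCfg ω₁ ∧ IsForestCfg (ω₁ ∆ (M ∩ E₁))) := fun ω₁ => by
    rw [hS₁, Finset.mem_filter]; simp only [Finset.mem_univ, true_and]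
  have memF₁ : ∀ ω₁, ω₁ ∈ Finset.univ.filter (fun ω₁ : BondConfig V => ω₁ \ (M ∩ E₁) = u ∩ E₁) ↔ ω₁ \ (M ∩ E₁) = u ∩ E₁ :=
    fun ω₁ => by rw [Finset.mem_filter]; simp only [Finset.mem_univ, true_and]
  -- STEP 1: `bad = Σ_{S₁} g (p ω₁) (q ω₁)`
  have hbad : fibreCount M u (forestEv V ∩ {ω | e ∈ ω ∧ f ∈ ω}) (forestEv V) = ∑ ω₁ ∈ S₁, g (p ω₁) (q ω₁) := by
    rw [fibreCount_eq_sum_twoSep hd hMu]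
    symm
    refine (Finset.sum_subset (fun ω₁ hω₁ => (memF₁ ω₁).2 ((memS₁ ω₁).1 hω₁).1) (fun ω₁ hF₁ hnot => ?_)).symm.trans ?_ |>.symm
    · -- off `S₁` the side-2 count vanishes
      have hω₁ := (memF₁ ω₁).1 hF₁
      rw [memS₁, not_and] at hnot
      refine fibreCount_eq_zero_of_forall _ _ _ _ fun ω₂ hω₂ hA hB => hnot hω₁ ?_
      obtain ⟨hF, heω, -⟩ := hA
      have hF' := (glue (sub₁ hω₁) (sub₂ hω₂)).1 hF
      have hB' := (glue (subB₁ hω₁) (subB₂ hω₂)).1 hB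
      exact ⟨((mem_union _ _ _).1 heω).resolve_right fun h => heE₂ (sub₂ hω₂ h), hF'.1, hB'.1⟩
    · refine Finset.sum_congr rfl fun ω₁ hω₁ => ?_
      obtain ⟨hω₁, heω₁, hF₁, hB₁⟩ := (memS₁ ω₁).1 hω₁
      rw [hg]
      refine fibreCount_congr_fibre _ _ fun ω₂ hω₂ => ?_
      simp only [mem_inter_iff, mem_setOf_eq, forestEv, hpiff, hqiff]
      constructor
      · rintro ⟨⟨hF, -, hfω⟩, hB⟩
        have hF' := (glue (sub₁ hω₁) (sub₂ hω₂)).1 hF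
        have hB' := (glue (subB₁ hω₁) (subB₂ hω₂)).1 hB
        have hf2 : f ∈ ω₂ := ((mem_union _ _ _).1 hfω).resolve_left fun h => hfE₁ (sub₁ hω₁ h)
        exact ⟨⟨⟨hF'.2.1, hf2⟩, hF'.2.2⟩, hB'.2.1, hB'.2.2⟩
      · rintro ⟨⟨⟨hF₂, hf2⟩, hna⟩, hB₂, hnb⟩
        exact ⟨⟨(glue (sub₁ hω₁) (sub₂ hω₂)).2 ⟨hF₁, hF₂, hna⟩, mem_union_left _ heω₁, mem_union_right _ hf2⟩,
          (glue (subB₁ hω₁) (subB₂ hω₂)).2 ⟨hB₁, hB₂, hnb⟩⟩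
  -- STEP 2: `good = Σ_{S₁} g (q ω₁) (p ω₁)` (side-2 involution = `fibreCount_swap`)
  have hgood : fibreCount M u (forestEv V ∩ {ω | e ∈ ω}) (forestEv V ∩ {ω | f ∈ ω}) = ∑ ω₁ ∈ S₁, g (q ω₁) (p ω₁) := by
    rw [fibreCount_eq_sum_twoSep hd hMu]
    symm
    refine (Finset.sum_subset (fun ω₁ hω₁ => (memF₁ ω₁).2 ((memS₁ ω₁).1 hω₁).1) (fun ω₁ hF₁ hnot => ?_)).symm.trans ?_ |>.symm
    · have hω₁ := (memF₁ ω₁).1 hF₁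
      rw [memS₁, not_and] at hnot
      refine fibreCount_eq_zero_of_forall _ _ _ _ fun ω₂ hω₂ hA hB => hnot hω₁ ?_
      obtain ⟨hF, heω⟩ := hA
      have hF' := (glue (sub₁ hω₁) (sub₂ hω₂)).1 hF
      have hB' := (glue (subB₁ hω₁) (subB₂ hω₂)).1 hB.1
      exact ⟨((mem_union _ _ _).1 heω).resolve_right fun h => heE₂ (sub₂ hω₂ h), hF'.1, hB'.1⟩
    · refine Finset.sum_congr rfl fun ω₁ hω₁ => ?_
      obtain ⟨hω₁, heω₁, hF₁, hB₁⟩ := (memS₁ ω₁).1 hω₁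
      rw [hg, fibreCount_swap (M ∩ E₂) (u ∩ E₂) {ω₂ | ω₁ ∪ ω₂ ∈ forestEv V ∩ {ω | e ∈ ω}}]
      refine fibreCount_congr_fibre _ _ fun ω₂ hω₂ => ?_
      have hω₂' : (ω₂ ∆ (M ∩ E₂)) \ (M ∩ E₂) = u ∩ E₂ := by rw [symmDiff_sdiff_eq_of_subset (subset_refl _), hω₂]
      simp only [mem_inter_iff, mem_setOf_eq, forestEv, hpiff, hqiff]
      constructor
      · rintro ⟨⟨hB, hfω⟩, hF, -⟩
        -- here `hB : IsForestCfg ((ω₁ ∆ M₁) ∪ ω₂)`, `hF : IsForestCfg (ω₁ ∪ (ω₂ ∆ M₂))`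
        have hB' := (glue (subB₁ hω₁) (sub₂ hω₂)).1 hB
        have hF' := (glue (sub₁ hω₁) (subB₂ hω₂)).1 hF
        have hf2 : f ∈ ω₂ := ((mem_union _ _ _).1 hfω).resolve_left fun h => hfE₁ (subB₁ hω₁ h)
        exact ⟨⟨⟨hB'.2.1, hf2⟩, hB'.2.2⟩, hF'.2.1, hF'.2.2⟩
      · rintro ⟨⟨⟨hF₂, hf2⟩, hnb⟩, hB₂, hna⟩
        exact ⟨⟨(glue (subB₁ hω₁) (sub₂ hω₂)).2 ⟨hB₁, hF₂, hnb⟩, mem_union_right _ hf2⟩,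
          (glue (sub₁ hω₁) (subB₂ hω₂)).2 ⟨hF₁, hB₂, hna⟩, mem_union_left _ heω₁⟩
  -- STEP 3: the hypotheses in the form of `sum_swap_le`
  have hgval : g true false ≤ g false true := by
    rw [hg, hg]
    -- side-2 totals: `#{¬α} + #{α} = T = #{¬β} + #{β}` with `#{β} ≤ #{α}` (H₂)
    have hT₁ : fibreCount (M ∩ E₂) (u ∩ E₂) (forestEv V ∩ {ω | f ∈ ω} ∩ {ω | ¬ (true = true ∧ (openGraph ω).Reachable a b)})
        (forestEv V ∩ {ω | ¬ (false = true ∧ (openGraph ω).Reachable a b)}) +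
        fibreCount (M ∩ E₂) (u ∩ E₂) (forestEv V ∩ {ω | f ∈ ω} ∩ {ω | (openGraph ω).Reachable a b}) (forestEv V) =
        fibreCount (M ∩ E₂) (u ∩ E₂) (forestEv V ∩ {ω | f ∈ ω}) (forestEv V) := by
      rw [fibreCount_congr_fibre (M ∩ E₂) (u ∩ E₂) (A' := forestEv V ∩ {ω | f ∈ ω} ∩ {ω | ¬ (openGraph ω).Reachable a b})
        (B' := forestEv V) (fun ω _ => by simp only [mem_inter_iff, mem_setOf_eq, true_and, Bool.false_eq_true, false_and, not_false_eq_true, and_true]),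
        ← fibreCount_split_left _ _ _ (Set.disjoint_left.2 fun ω h₁ h₂ => h₁.2 h₂.2)]
      exact fibreCount_congr_fibre _ _ fun ω _ => by simp only [mem_union, mem_inter_iff, mem_setOf_eq]; tauto
    have hT₂ : fibreCount (M ∩ E₂) (u ∩ E₂) (forestEv V ∩ {ω | f ∈ ω} ∩ {ω | ¬ (false = true ∧ (openGraph ω).Reachable a b)})
        (forestEv V ∩ {ω | ¬ (true = true ∧ (openGraph ω).Reachable a b)}) +
        fibreCount (M ∩ E₂) (u ∩ E₂) (forestEv V ∩ {ω | f ∈ ω}) (forestEv V ∩ {ω | (openGraph ω).Reachable a b}) =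
        fibreCount (M ∩ E₂) (u ∩ E₂) (forestEv V ∩ {ω | f ∈ ω}) (forestEv V) := by
      rw [fibreCount_swap (M ∩ E₂) (u ∩ E₂) (forestEv V ∩ {ω | f ∈ ω} ∩ _), fibreCount_swap (M ∩ E₂) (u ∩ E₂) (forestEv V ∩ {ω | f ∈ ω}),
        fibreCount_swap (M ∩ E₂) (u ∩ E₂) (forestEv V ∩ {ω | f ∈ ω}) (forestEv V),
        fibreCount_congr_fibre (M ∩ E₂) (u ∩ E₂) (A' := forestEv V ∩ {ω | ¬ (openGraph ω).Reachable a b})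
        (B' := forestEv V ∩ {ω | f ∈ ω}) (fun ω _ => by simp only [mem_inter_iff, mem_setOf_eq, true_and, Bool.false_eq_true, false_and, not_false_eq_true, and_true]),
        ← fibreCount_split_left _ _ _ (Set.disjoint_left.2 fun ω h₁ h₂ => h₁.2 h₂.2)]
      exact fibreCount_congr_fibre _ _ fun ω _ => by simp only [mem_union, mem_inter_iff, mem_setOf_eq]; tauto
    omega
  have hcval : (S₁.filter fun ω₁ => q ω₁ = true).card ≤ (S₁.filter fun ω₁ => p ω₁ = true).card := by
    have e1 : fibreCount (M ∩ E₁) (u ∩ E₁) (forestEv V ∩ {ω | e ∈ ω}) (forestEv V ∩ {ω | (openGraph ω).Reachable a b}) =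
        (S₁.filter fun ω₁ => q ω₁ = true).card := by
      refine fibreCount_eq_card_of_iff _ _ _ _ _ fun ω₁ => ?_
      rw [Finset.mem_filter, memS₁]
      simp only [mem_inter_iff, mem_setOf_eq, forestEv, hqiff]; tauto
    have e2 : fibreCount (M ∩ E₁) (u ∩ E₁) (forestEv V ∩ {ω | e ∈ ω} ∩ {ω | (openGraph ω).Reachable a b}) (forestEv V) =
        (S₁.filter fun ω₁ => p ω₁ = true).card := by
      refine fibreCount_eq_card_of_iff _ _ _ _ _ fun ω₁ => ?_
      rw [Finset.mem_filter, memS₁]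
      simp only [mem_inter_iff, mem_setOf_eq, forestEv, hpiff]; tauto
    rw [← e1, ← e2]; exact H₁
  -- STEP 4: rearrangement
  rw [hbad, hgood]
  exact sum_swap_le S₁ p q g hgval hcval

end TwoSum

end FK

end Summit.CriticalPhenomena.PercolationContinuityZ3.Theorems

end
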